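import Literature.NumberTheory.GaloisRepresentations.ResidualGaloisRep
import Literature.RepresentationTheory.Semisimple.FinTwoSemisimplification
import Mathlib.LinearAlgebra.Eigenspace.Minpoly
import HarnessLib

/-!
# Rank-two representations with the characteristic polynomials of an `S₃`-image mod-`2` representation
# have no stable line, and any two of them are conjugate (Brauer–Nesbitt) — the representation-theoretic
# core of the residual isomorphism `A_g[ϖ] ≅ W[2] ⊗ k` of the θ-transport line (crux (R≥)ᵖ, stub `stub_transport` (b))

Route `ResidualThetaTransportAtTwo` (RTT), crux (R≥)ᵖ `ResidualThetaCountLowerPureAtTwo`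
(stmt-BirchSwinnertonDyer-26074), line «bt26-lambda» (`Cruxes/ResidualThetaCountLowerPureAtTwo/Lines/bt26_lambda.lean`);
seat `prover-bsd-wall-rtt-p2` g12 (`--supports`, closes nothing). HONEST FRAMING: THEOREMS ONLY (no definition,
no named fact, no instance, no `sorry`); pure representation theory of an abstract group `G` over an abstract
field `k`; nothing about any curve, form or Selmer group is asserted; BSD is not proved by any of this.

WHY. Step (b) of `stub_transport` (card `Lines/bt26-lambda.md`) is the residual isomorphism
`ρ̄_{g,ϖ} ≅ ρ̄_{W,2} ⊗_{𝔽₂} k` (`k = 𝒪/ϖ`) from the congruence of Frobenius traces. After Chebotarev (companion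
file) both sides are homomorphisms `G = Γ_ℚ → GL₂` with
`charpoly(ψ σ) = charpoly(τ σ) ⊗ k` for ALL `σ`, where `τ : G → M₂(𝔽₂)` is `ρ̄_{W,2}` in a frame of `W[2]`.
Brauer–Nesbitt (the tree's PROVED `brauerNesbitt_holds`) needs both representations SEMISIMPLE; in rank two
this is irreducibility, and irreducibility of BOTH follows from one cheap invariant of the habitat image
`ρ̄_{W,2}(Γ_ℚ) = GL₂(𝔽₂) ≅ S₃`: a commutator `c = [g, h]` on which `τ` has trace `1` (a `3`-cycle).

WHAT.
* `isIrreducible_glRepresentation_of_charpoly_eq_map` — **no stable line**: if `ψ : G →* GL₂(k)` has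
  `charpoly (ψ σ) = (charpoly (τ σ)).map f` for all `σ` (`f : 𝔽₂ →+* k`), `det ∘ τ = 1`, and some commutator
  `c = g h g⁻¹ h⁻¹` has `tr τ(c) = 1`, then `k²` is an irreducible `G`-module through `ψ`. (A stable line
  `k w` gives an eigen-character `χ : G → kˣ`; `χ(c) = 1` since `kˣ` is commutative; Cayley–Hamilton on `w`
  gives `χ(c)² − tr·χ(c) + det = 1 − 1 + 1 = 0`, absurd.)
* `exists_conj_eq_of_charpoly_eq_map` — **conjugacy**: two such `ψ₁, ψ₂` are conjugate,
  `ψ₂ σ = P ψ₁ σ P⁻¹` for one `P ∈ GL₂(k)` (Brauer–Nesbitt `brauerNesbitt_holds` + the matrix of the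
  intertwining isomorphism).
* `exists_conj_map_eq_of_charpoly_eq_map` — the instance `ψ₂ = τ ⊗ k`:
  `(τ σ).map f = P (ψ σ) P⁻¹`.

References: [DarmonDiamondTaylor1995] Prop. 2.6 (b) (a semisimple mod-`ℓ` representation is determined by
characteristic polynomials; Chebotarev + Brauer–Nesbitt); [BourbakiAlgebreVIII2012] VIII §20 n°6 Cor. 1
(Brauer–Nesbitt); [SerreInventiones1972] §5.3 (the image `GL₂(𝔽₂) ≅ S₃` on the `2`-torsion).
-/

set_option autoImplicit false
-- the Theorems namespace of this sub repeats the summit name by design (D-0017 nested layout)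
set_option linter.dupNamespace false

noncomputable section

open scoped MatrixGroups
open Matrix Polynomial Module Literature.NumberTheory.GaloisRepresentations

namespace Summit.BirchSwinnertonDyer.BirchSwinnertonDyer.Theorems.ThetaTransport

universe u v

variable {k : Type u} [Field k] {G : Type v} [Group G]

/-- The linear map `glRepresentation ψ σ` on `k²` is `Matrix.toLin'` of the matrix `ψ σ`. [folklore] -/
theorem glRepresentation_eq_toLin' {n : ℕ} (ψ : G →* GL (Fin n) k) (σ : G) :
    (glRepresentation ψ σ : (Fin n → k) →ₗ[k] (Fin n → k)) =
      Matrix.toLin' ((ψ σ : GL (Fin n) k) : Matrix (Fin n) (Fin n) k) :=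
  LinearMap.ext fun v => by rw [glRepresentation_apply_apply, Matrix.toLin'_apply]

/-- The characteristic polynomial of `glRepresentation ψ σ` is that of the matrix `ψ σ`
(Mathlib `Matrix.charpoly_toLin'`). [folklore] -/
theorem charpoly_glRepresentation {n : ℕ} (ψ : G →* GL (Fin n) k) (σ : G) :
    (glRepresentation ψ σ).charpoly = ((ψ σ : GL (Fin n) k) : Matrix (Fin n) (Fin n) k).charpoly := by
  rw [glRepresentation_eq_toLin', Matrix.charpoly_toLin']

/-- **No stable line.** Let `τ : G →* M₂(𝔽₂)` take values of determinant `1` and have trace `1` on some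
commutator `g h g⁻¹ h⁻¹`, let `f : 𝔽₂ →+* k`, and let `ψ : G →* GL₂(k)` have
`charpoly (ψ σ) = (charpoly (τ σ)).map f` for every `σ`. Then the representation of `G` on `k²` through
`ψ` is irreducible. (A stable line `k w` carries an eigen-character `χ`; `χ` kills commutators, and
Cayley–Hamilton on `w` at the commutator reads `1 − 1 + 1 = 0` in `k`.)
[cite: DarmonDiamondTaylor1995, Prop. 2.6 (b) (PDF p. 53)] [cite: SerreInventiones1972, §5.3] -/
theorem isIrreducible_glRepresentation_of_charpoly_eq_map
    (τ : G →* Matrix (Fin 2) (Fin 2) (ZMod 2)) (f : ZMod 2 →+* k) (ψ : G →* GL (Fin 2) k)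
    (hchar : ∀ σ, ((ψ σ : GL (Fin 2) k) : Matrix (Fin 2) (Fin 2) k).charpoly = ((τ σ).charpoly).map f)
    (hdet : ∀ σ, (τ σ).det = 1)
    (hcomm : ∃ g h : G, (τ (g * h * g⁻¹ * h⁻¹)).trace = 1) :
    (glRepresentation ψ).IsIrreducible := by
  classical
  set R := glRepresentation ψ with hR
  by_contra hirr
  -- a proper non-zero subrepresentation, i.e. a stable line `k w`
  have hbot : (⊥ : Subrepresentation R).toSubmodule = ⊥ := rfl
  have htop : (⊤ : Subrepresentation R).toSubmodule = ⊤ := rfl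
  have hbt : (⊥ : Subrepresentation R) ≠ ⊤ := by
    intro h
    have h' := congrArg Subrepresentation.toSubmodule h
    rw [hbot, htop] at h'
    exact bot_ne_top h'
  obtain ⟨U, hU0, hU1⟩ : ∃ U : Subrepresentation R, U ≠ ⊥ ∧ U ≠ ⊤ := by
    by_contra hcon
    push Not at hcon
    haveI : Nontrivial (Subrepresentation R) := ⟨⟨⊥, ⊤, hbt⟩⟩
    exact hirr ⟨fun U ↦ or_iff_not_imp_left.mpr (hcon U)⟩
  have hU0' : U.toSubmodule ≠ ⊥ := fun h ↦ hU0 (Subrepresentation.toSubmodule_injective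
    (by rw [h, hbot]))
  have hU1' : U.toSubmodule ≠ ⊤ := fun h ↦ hU1 (Subrepresentation.toSubmodule_injective
    (by rw [h, htop]))
  have hUrank : finrank k U.toSubmodule = 1 :=
    Literature.RepresentationTheory.Semisimple.finrank_eq_one_of_ne_bot_of_ne_top hU0' hU1'
  obtain ⟨w, hwU, hw0⟩ := Submodule.exists_mem_ne_zero_of_ne_bot hU0'
  have hmult : ∀ v ∈ U.toSubmodule, ∃ c : k, c • w = v := by
    intro v hv
    have h1 := (finrank_eq_one_iff_of_nonzero' (⟨w, hwU⟩ : U.toSubmodule)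
      (by exact_mod_cast Subtype.coe_ne_coe.mp hw0 : (⟨w, hwU⟩ : U.toSubmodule) ≠ 0)).mp hUrank ⟨v, hv⟩
    obtain ⟨c, hc⟩ := h1
    exact ⟨c, by simpa using congrArg Subtype.val hc⟩
  -- the eigen-character `χ`
  have hex : ∀ σ : G, ∃ c : k, c • w = R σ w := fun σ ↦ hmult _ (U.apply_mem_toSubmodule σ hwU)
  choose χ hχ using hex
  have hmul : ∀ a b : G, χ (a * b) = χ a * χ b := by
    intro a b
    refine smul_left_injective k hw0 ?_
    change χ (a * b) • w = (χ a * χ b) • w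
    rw [hχ, map_mul, Module.End.mul_apply, ← hχ b, map_smul, ← hχ a, smul_smul, mul_comm]
  have hone : χ 1 = 1 := by
    refine smul_left_injective k hw0 ?_
    change χ 1 • w = (1 : k) • w
    rw [hχ, map_one, Module.End.one_apply, one_smul]
  have hne : ∀ a : G, χ a ≠ 0 := by
    intro a h0
    have h1 : χ (a⁻¹ * a) = 1 := by rw [inv_mul_cancel, hone]
    rw [hmul, h0, mul_zero] at h1
    exact zero_ne_one h1
  have hinv : ∀ a : G, χ a⁻¹ = (χ a)⁻¹ := fun a ↦
    eq_inv_of_mul_eq_one_left (by rw [← hmul, inv_mul_cancel, hone])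
  -- the commutator has `χ = 1`
  obtain ⟨g, h, hc⟩ := hcomm
  set c : G := g * h * g⁻¹ * h⁻¹ with hcdef
  have hχc : χ c = 1 := by
    rw [hcdef, hmul, hmul, hmul, hinv, hinv]
    calc χ g * χ h * (χ g)⁻¹ * (χ h)⁻¹ = (χ g * (χ g)⁻¹) * (χ h * (χ h)⁻¹) := by ring
      _ = 1 := by rw [mul_inv_cancel₀ (hne g), mul_inv_cancel₀ (hne h), one_mul]
  -- Cayley–Hamilton on the eigenvector `w` at `c`
  have hev : Module.End.HasEigenvector (R c) (χ c) w :=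
    ⟨Module.End.mem_eigenspace_iff.mpr (hχ c).symm, hw0⟩
  have hCH := Module.End.aeval_apply_of_hasEigenvector (p := (R c).charpoly) hev
  rw [LinearMap.aeval_self_charpoly, LinearMap.zero_apply, hR, charpoly_glRepresentation, hchar c,
    Matrix.charpoly_fin_two, hχc] at hCH
  have hev1 : ((X ^ 2 - C (τ c).trace * X + C (τ c).det).map f).eval (1 : k) = 1 := by
    rw [hc, hdet c]
    simp
  rw [hev1, one_smul] at hCH
  exact hw0 hCH.symm

/-- The matrix of an intertwining isomorphism `φ : k^n ≃ k^n` between `glRepresentation ψ₁` and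
`glRepresentation ψ₂` conjugates `ψ₁` into `ψ₂`. [folklore] -/
theorem exists_conj_eq_of_equiv {n : ℕ} (ψ₁ ψ₂ : G →* GL (Fin n) k)
    (φ : (glRepresentation ψ₁).Equiv (glRepresentation ψ₂)) :
    ∃ P : GL (Fin n) k, ∀ σ,
      ((ψ₂ σ : GL (Fin n) k) : Matrix (Fin n) (Fin n) k) =
        (P : Matrix (Fin n) (Fin n) k) * (ψ₁ σ : GL (Fin n) k) * ((P⁻¹ : GL (Fin n) k) : Matrix (Fin n) (Fin n) k) := by
  classical
  let e : (Fin n → k) ≃ₗ[k] (Fin n → k) := φ.toLinearEquiv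
  let A : Matrix (Fin n) (Fin n) k := LinearMap.toMatrix' (e : (Fin n → k) →ₗ[k] (Fin n → k))
  let B : Matrix (Fin n) (Fin n) k := LinearMap.toMatrix' (e.symm : (Fin n → k) →ₗ[k] (Fin n → k))
  have hAB : A * B = 1 := by
    rw [← LinearMap.toMatrix'_comp, LinearEquiv.comp_coe, LinearEquiv.symm_trans_self,
      LinearEquiv.refl_toLinearMap, LinearMap.toMatrix'_id]
  have hBA : B * A = 1 := by
    rw [← LinearMap.toMatrix'_comp, LinearEquiv.comp_coe, LinearEquiv.self_trans_symm,
      LinearEquiv.refl_toLinearMap, LinearMap.toMatrix'_id]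
  let P : GL (Fin n) k := ⟨A, B, hAB, hBA⟩
  refine ⟨P, fun σ => ?_⟩
  -- equivariance: `e ∘ ψ₁ σ = ψ₂ σ ∘ e`
  have heq : (e : (Fin n → k) →ₗ[k] (Fin n → k)) ∘ₗ (glRepresentation ψ₁ σ) =
      (glRepresentation ψ₂ σ) ∘ₗ (e : (Fin n → k) →ₗ[k] (Fin n → k)) := φ.isIntertwining' σ
  have hmat : A * ((ψ₁ σ : GL (Fin n) k) : Matrix (Fin n) (Fin n) k) =
      ((ψ₂ σ : GL (Fin n) k) : Matrix (Fin n) (Fin n) k) * A := by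
    have h1 := congrArg LinearMap.toMatrix' heq
    rw [LinearMap.toMatrix'_comp, LinearMap.toMatrix'_comp, glRepresentation_eq_toLin',
      glRepresentation_eq_toLin', LinearMap.toMatrix'_toLin', LinearMap.toMatrix'_toLin'] at h1
    exact h1
  change ((ψ₂ σ : GL (Fin n) k) : Matrix (Fin n) (Fin n) k) = A * (ψ₁ σ : GL (Fin n) k) * B
  rw [hmat, Matrix.mul_assoc, hAB, Matrix.mul_one]

/-- **Conjugacy (Brauer–Nesbitt).** Two homomorphisms `ψ₁, ψ₂ : G →* GL₂(k)` whose characteristic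
polynomials are both `(charpoly ∘ τ) ⊗ k` for a `τ : G →* M₂(𝔽₂)` as in
`isIrreducible_glRepresentation_of_charpoly_eq_map` are conjugate: `ψ₂ σ = P ψ₁ σ P⁻¹`. Both are irreducible
(hence semisimple) by that theorem, they have the same characteristic polynomials, and the Brauer–Nesbitt
theorem (the tree's PROVED `brauerNesbitt_holds`) gives an intertwining isomorphism.
[cite: BourbakiAlgebreVIII2012, VIII § 20 n° 6, Thm. 2, Cor. 1 (p. 378)]
[cite: DarmonDiamondTaylor1995, Prop. 2.6 (b) (PDF p. 53)] -/
theorem exists_conj_eq_of_charpoly_eq_map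
    (τ : G →* Matrix (Fin 2) (Fin 2) (ZMod 2)) (f : ZMod 2 →+* k) (ψ₁ ψ₂ : G →* GL (Fin 2) k)
    (h₁ : ∀ σ, ((ψ₁ σ : GL (Fin 2) k) : Matrix (Fin 2) (Fin 2) k).charpoly = ((τ σ).charpoly).map f)
    (h₂ : ∀ σ, ((ψ₂ σ : GL (Fin 2) k) : Matrix (Fin 2) (Fin 2) k).charpoly = ((τ σ).charpoly).map f)
    (hdet : ∀ σ, (τ σ).det = 1)
    (hcomm : ∃ g h : G, (τ (g * h * g⁻¹ * h⁻¹)).trace = 1) :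
    ∃ P : GL (Fin 2) k, ∀ σ,
      ((ψ₂ σ : GL (Fin 2) k) : Matrix (Fin 2) (Fin 2) k) =
        (P : Matrix (Fin 2) (Fin 2) k) * (ψ₁ σ : GL (Fin 2) k) * ((P⁻¹ : GL (Fin 2) k) : Matrix (Fin 2) (Fin 2) k) := by
  haveI hI₁ : (glRepresentation ψ₁).IsIrreducible :=
    isIrreducible_glRepresentation_of_charpoly_eq_map τ f ψ₁ h₁ hdet hcomm
  haveI hI₂ : (glRepresentation ψ₂).IsIrreducible :=
    isIrreducible_glRepresentation_of_charpoly_eq_map τ f ψ₂ h₂ hdet hcomm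
  have hss₁ : (glRepresentation ψ₁).IsSemisimpleRepresentation := inferInstance
  have hss₂ : (glRepresentation ψ₂).IsSemisimpleRepresentation := inferInstance
  have hcp : ∀ σ, (glRepresentation ψ₁ σ).charpoly = (glRepresentation ψ₂ σ).charpoly := fun σ ↦ by
    rw [charpoly_glRepresentation, charpoly_glRepresentation, h₁, h₂]
  obtain ⟨φ⟩ := brauerNesbitt_holds (glRepresentation ψ₁) (glRepresentation ψ₂) hss₁ hss₂ hcp
  exact exists_conj_eq_of_equiv ψ₁ ψ₂ φ

/-- **The residual conjugacy in the shape used by the θ-transport line**: with `τ`, `f`, `hdet`, `hcomm` as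
above and ONE `ψ : G →* GL₂(k)` with `charpoly (ψ σ) = (charpoly (τ σ)).map f`, the base change `τ ⊗_f k`
is conjugate to `ψ`: `(τ σ).map f = P (ψ σ) P⁻¹` for one `P ∈ GL₂(k)` and all `σ`.
[cite: DarmonDiamondTaylor1995, Prop. 2.6 (b) (PDF p. 53)]
[cite: BourbakiAlgebreVIII2012, VIII § 20 n° 6, Thm. 2, Cor. 1 (p. 378)] -/
theorem exists_conj_map_eq_of_charpoly_eq_map
    (τ : G →* Matrix (Fin 2) (Fin 2) (ZMod 2)) (f : ZMod 2 →+* k) (ψ : G →* GL (Fin 2) k)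
    (hchar : ∀ σ, ((ψ σ : GL (Fin 2) k) : Matrix (Fin 2) (Fin 2) k).charpoly = ((τ σ).charpoly).map f)
    (hdet : ∀ σ, (τ σ).det = 1)
    (hcomm : ∃ g h : G, (τ (g * h * g⁻¹ * h⁻¹)).trace = 1) :
    ∃ P : GL (Fin 2) k, ∀ σ,
      (τ σ).map f =
        (P : Matrix (Fin 2) (Fin 2) k) * (ψ σ : GL (Fin 2) k) * ((P⁻¹ : GL (Fin 2) k) : Matrix (Fin 2) (Fin 2) k) := by
  classical
  -- `τ ⊗ k` as a homomorphism into `GL₂(k)`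
  let τk : G →* GL (Fin 2) k := (Matrix.GeneralLinearGroup.map f).comp τ.toHomUnits
  have hτk : ∀ σ, ((τk σ : GL (Fin 2) k) : Matrix (Fin 2) (Fin 2) k) = (τ σ).map f := fun σ ↦ rfl
  have h₂ : ∀ σ, ((τk σ : GL (Fin 2) k) : Matrix (Fin 2) (Fin 2) k).charpoly = ((τ σ).charpoly).map f :=
    fun σ ↦ by rw [hτk, Matrix.charpoly_map]
  obtain ⟨P, hP⟩ := exists_conj_eq_of_charpoly_eq_map τ f ψ τk hchar h₂ hdet hcomm
  exact ⟨P, fun σ ↦ by rw [← hτk, hP σ]⟩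

end Summit.BirchSwinnertonDyer.BirchSwinnertonDyer.Theorems.ThetaTransport

end
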